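import Literature.RepresentationTheory.TwistedCoinvariantsTensorQuotientLift
import Literature.NumberTheory.Automorphic.Liu2021.AppendixC.Thm415Pinned
import HarnessLib

/-!
# [Liu 2021, proof of Thm. 4.15] the per-label factorisation of a Hecke-equivariant map into `ℚ_ℓ^{ac} ⊗ H¹_ét` through the
# central-character coinvariants of a tensor product, with equivariant slices

Topic `NumberTheory/Automorphic/Liu2021/AppendixC`; namespace `Literature.NumberTheory.Automorphic.Liu2021.AppendixC.Sec42Data.EtaleHeckeDatum`
(sequel of `Thm415Pinned`: `EtaleHeckeDatum.omegaHom`, `mem_omegaHom_iff`) over the generic `TwistedCoinv` algebra of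
`RepresentationTheory/TwistedCoinvariantsTensorQuotient` (`coinvTprodQuot`, `_rep`, `_surjective`) and `…TensorQuotientLift`
(`repFst`, `coinvTprodQuot_repFst`, `coinvTprodQuot_liftₛₗ`).  THEOREMS ONLY; no definition, no named fact, no instance, no `sorry`.

GENERIC over a tower datum `C : Sec42Data P5 isotropicAt` and an étale Hecke datum `X : C.EtaleHeckeDatum ℓ` (group `𝔾 := C.G`): let
`H` be commutative (the common centre), `ρ₁, ρ₂` representations of `H` with a diagonal character `χ`, `ρV` a `𝔾`-action on the
first factor commuting with `ρ₁` whose centre `zc : H →* 𝔾` acts through `ρ₁` up to units `c`, (f1) `Φ : W ≃ Coinv (ρ₁ ⊗ ρ₂) χ` an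
identification of a `𝔾`-module `(W, ρ)` intertwining `ρ` with `ρV ⊗ 1`, (f1′) `e : Coinv ρ₁ ψ′ ≃ W₁` intertwining the descended `ρV`
with `ρ′`, and `P` an `H¹`-side projector commuting with the Hecke operators on which the centre acts by the scalar `ι (ψ′ · c)`.
* `rep_tprod_one_center` — the centre of `𝔾` acts on `Coinv (ρ₁ ⊗ ρ₂) χ` through the first factor;
* `comp_repFst_eq_smul` — for `f′ ∈ X.omegaHom ι ρ`, `P ∘ f′ ∘ Φ⁻¹` is `ψ′`-isotypic for the first factor's `H`-action;
* `factor_rTensor_rep` — hence factors through `q_{ψ′}` (`coinvTprodQuot_liftₛₗ`), equivariantly;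
* `slice_mem_omegaHom` — every slice `x ↦ g (x ⊗ m)` of the factor map lies in `X.omegaHom ι ρ′`;
* **`exists_factor_slice_mem_omegaHom`** — the packaged statement: `P ∘ f′ = g ∘ ((e ⊗ 1) ∘ q_{ψ′} ∘ Φ)` with all slices of `g`
  in `X.omegaHom ι ρ′` — the `(M i, q i, g)` tail of the see-saw decomposition at one label, `M i := Coinv ρ₂ (χψ′⁻¹)`
  ([Liu2021] proof of Thm. 4.15, l. 2199–2212: «`H¹ ⊗ ℚ_ℓ^{ac} = ⊕ π^∞ ⊗ ρ_π`, restricted to the face, decomposes along the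
  central characters of the first factor»; [GelbartRogawski1991] §3.1 pp. 454–457).

## References
* [Liu2021] Y. Liu, Camb. J. Math. 9 (2021): proof of Thm. 4.15 (FJcycle.tex l. 2199–2212; print pp. 50–51), App. D §D.1
  Step 3 (l. 5221).
* [GelbartRogawski1991] S. Gelbart, J. Rogawski, Invent. Math. 105 (1991), §3.1 pp. 454–457.
-/

set_option autoImplicit false

noncomputable section

namespace Literature.NumberTheory.Automorphic.Liu2021.AppendixC.Sec42Data.EtaleHeckeDatum

open _root_.NumberField
open Literature.RepresentationTheory Literature.RepresentationTheory.TwistedCoinv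
open scoped TensorProduct

variable {F E : Type} [Field F] [NumberField F] [_root_.NumberField.IsTotallyReal F] [Field E] [NumberField E] [Algebra F E]
  [_root_.NumberField.IsTotallyComplex E] [Algebra.IsQuadraticExtension F E]
variable {P5 : PropC5Data F E} {isotropicAt : ℕ → Prop}
variable {C : Sec42Data P5 isotropicAt} {ℓ : ℕ} [Fact ℓ.Prime]

section Transfer

variable (X : C.EtaleHeckeDatum ℓ) (ι : ℂ ≃+* AlgebraicClosure ℚ_[ℓ])
  {H : Type} [CommGroup H] {S₁ S₂ W W₁ : Type}
  [AddCommGroup S₁] [Module ℂ S₁] [AddCommGroup S₂] [Module ℂ S₂] [AddCommGroup W] [Module ℂ W]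
  [AddCommGroup W₁] [Module ℂ W₁]
  (ρ₁ : Representation ℂ H S₁) (ρ₂ : Representation ℂ H S₂) (χ ψ' : H →* ℂˣ)
  (ρV : Representation ℂ C.G S₁) (zc : H →* C.G) (c : H → ℂˣ)
  (ρ : Representation ℂ C.G W) (Φ : W ≃ₗ[ℂ] Coinv (ρ₁.tprod ρ₂) χ)
  (ρ' : Representation ℂ C.G W₁) (e : Coinv ρ₁ ψ' ≃ₗ[ℂ] W₁)
  (P : AlgebraicClosure ℚ_[ℓ] ⊗[ℚ_[ℓ]] C.etaleH1Tower ℓ →ₗ[AlgebraicClosure ℚ_[ℓ]]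
    AlgebraicClosure ℚ_[ℓ] ⊗[ℚ_[ℓ]] C.etaleH1Tower ℓ)

/-- **The centre of `𝔾` acts on `Coinv (ρ₁ ⊗ ρ₂) χ` through the first factor**: `rep (ρV ⊗ 1) (zc z) = c z • repFst z`
(★ `finPairRepV_finAdelicCenter` shape, read on the coinvariants). [cite: Liu2021, App. D §D.1 Step 3 (l. 5221)] -/
theorem rep_tprod_one_center (hc : ∀ (g : C.G) (h : H), Commute (ρV g) (ρ₁ h))
    (hzc : ∀ (z : H) (v : S₁), ρV (zc z) v = ((c z : ℂˣ) : ℂ) • ρ₁ z v) (z : H) (x : Coinv (ρ₁.tprod ρ₂) χ) :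
    rep χ (ρV.tprod (1 : Representation ℂ C.G S₂)) (commute_tprod_one ρ₁ ρ₂ ρV hc) (zc z) x =
      ((c z : ℂˣ) : ℂ) • repFst ρ₁ ρ₂ χ z x := by
  obtain ⟨t, rfl⟩ := mk_surjective (ρ₁.tprod ρ₂) χ x
  rw [rep_mk, repFst_mk, Representation.tprod_apply, MonoidHom.one_apply]
  have hz : ρV (zc z) = ((c z : ℂˣ) : ℂ) • ρ₁ z := LinearMap.ext (hzc z)
  rw [hz, TensorProduct.map_smul_left, LinearMap.smul_apply, map_smul]
  rfl

/-- **(f3, the intertwining through the centre)**: for `f′ ∈ X.omegaHom ι ρ`, the composite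
`L := P ∘ f′ ∘ Φ⁻¹ : Coinv (ρ₁ ⊗ ρ₂) χ →ₛₗ[ι] ℚ_ℓ^{ac} ⊗ H¹_ét` transforms under the first factor's `H`-action by `ι ∘ ψ′`.
[cite: Liu2021, proof of Thm. 4.15 (FJcycle.tex l. 2199–2212)] -/
theorem comp_repFst_eq_smul (hc : ∀ (g : C.G) (h : H), Commute (ρV g) (ρ₁ h))
    (hzc : ∀ (z : H) (v : S₁), ρV (zc z) v = ((c z : ℂˣ) : ℂ) • ρ₁ z v)
    (hΦ : ∀ (g : C.G) (w : W),
      Φ (ρ g w) = rep χ (ρV.tprod (1 : Representation ℂ C.G S₂)) (commute_tprod_one ρ₁ ρ₂ ρV hc) g (Φ w))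
    (hPT : ∀ (g : C.G) (x : AlgebraicClosure ℚ_[ℓ] ⊗[ℚ_[ℓ]] C.etaleH1Tower ℓ),
      P ((X.rhoEt g).baseChange (AlgebraicClosure ℚ_[ℓ]) x) = (X.rhoEt g).baseChange (AlgebraicClosure ℚ_[ℓ]) (P x))
    (hPz : ∀ (z : H) (x : AlgebraicClosure ℚ_[ℓ] ⊗[ℚ_[ℓ]] C.etaleH1Tower ℓ),
      (X.rhoEt (zc z)).baseChange (AlgebraicClosure ℚ_[ℓ]) (P x) = ι (((ψ' z : ℂˣ) : ℂ) * ((c z : ℂˣ) : ℂ)) • P x)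
    {f' : W →ₛₗ[(ι : ℂ →+* AlgebraicClosure ℚ_[ℓ])] AlgebraicClosure ℚ_[ℓ] ⊗[ℚ_[ℓ]] C.etaleH1Tower ℓ}
    (hf' : f' ∈ X.omegaHom ι ρ) (z : H) (x : Coinv (ρ₁.tprod ρ₂) χ) :
    (P.comp (f'.comp Φ.symm.toLinearMap)) (repFst ρ₁ ρ₂ χ z x) =
      (ι : ℂ →+* AlgebraicClosure ℚ_[ℓ]) ((ψ' z : ℂˣ) : ℂ) • (P.comp (f'.comp Φ.symm.toLinearMap)) x := by
  obtain ⟨w, rfl⟩ := Φ.surjective x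
  -- `repFst z (Φ w) = Φ ((c z)⁻¹ • ρ (zc z) w)`
  have h1 : repFst ρ₁ ρ₂ χ z (Φ w) = Φ ((((c z)⁻¹ : ℂˣ) : ℂ) • ρ (zc z) w) := by
    rw [LinearEquiv.map_smul, hΦ, rep_tprod_one_center ρ₁ ρ₂ χ ρV zc c hc hzc, smul_smul, Units.inv_mul, one_smul]
  -- the composite evaluated on `Φ w'` is `P (f' w')` (definitional unfolding + `Φ.symm (Φ w') = w'`)
  have h2 : ∀ w' : W, (P.comp (f'.comp Φ.symm.toLinearMap)) (Φ w') = P (f' w') := fun w' =>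
    congrArg (fun v => P (f' v)) (Φ.symm_apply_apply w')
  -- `f'` is `ι`-semilinear and intertwines `ρ (zc z)` with `rhoEt (zc z) ⊗ 1`
  have h3 : f' ((((c z)⁻¹ : ℂˣ) : ℂ) • ρ (zc z) w) =
      (ι : ℂ →+* AlgebraicClosure ℚ_[ℓ]) (((c z)⁻¹ : ℂˣ) : ℂ) • (X.rhoEt (zc z)).baseChange (AlgebraicClosure ℚ_[ℓ]) (f' w) := by
    rw [LinearMap.map_smulₛₗ, (X.mem_omegaHom_iff ι ρ f').1 hf' (zc z) w]
  -- the scalar bookkeeping `ι(c⁻¹) · ι(ψ′ c) = ι(ψ′)`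
  have h5 : (ι : ℂ →+* AlgebraicClosure ℚ_[ℓ]) (((c z)⁻¹ : ℂˣ) : ℂ) * ι (((ψ' z : ℂˣ) : ℂ) * ((c z : ℂˣ) : ℂ)) =
      (ι : ℂ →+* AlgebraicClosure ℚ_[ℓ]) ((ψ' z : ℂˣ) : ℂ) := by
    rw [RingHom.coe_coe, ← map_mul, Units.val_inv_eq_inv_val, mul_comm (((ψ' z : ℂˣ) : ℂ)) _, ← mul_assoc,
      inv_mul_cancel₀ (c z).ne_zero, one_mul]
  rw [h1, h2, h2, h3, LinearMap.map_smul, hPT (zc z) (f' w), hPz z (f' w), smul_smul, h5]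

/-- **equivariance of a factor through `q_{ψ′}`**: if `Lbar ∘ q_{ψ′} ∘ Φ = P ∘ f′` for `f′ ∈ X.omegaHom ι ρ`, then `Lbar`
intertwines `rep ψ′ ρV ⊗ 1` with the Hecke operators (`coinvTprodQuot_rep` + `q_{ψ′}` onto).
[cite: Liu2021, proof of Thm. 4.15 (FJcycle.tex l. 2199–2212)] -/
theorem factor_rTensor_rep (hc : ∀ (g : C.G) (h : H), Commute (ρV g) (ρ₁ h))
    (hΦ : ∀ (g : C.G) (w : W),
      Φ (ρ g w) = rep χ (ρV.tprod (1 : Representation ℂ C.G S₂)) (commute_tprod_one ρ₁ ρ₂ ρV hc) g (Φ w))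
    (hPT : ∀ (g : C.G) (x : AlgebraicClosure ℚ_[ℓ] ⊗[ℚ_[ℓ]] C.etaleH1Tower ℓ),
      P ((X.rhoEt g).baseChange (AlgebraicClosure ℚ_[ℓ]) x) = (X.rhoEt g).baseChange (AlgebraicClosure ℚ_[ℓ]) (P x))
    {f' : W →ₛₗ[(ι : ℂ →+* AlgebraicClosure ℚ_[ℓ])] AlgebraicClosure ℚ_[ℓ] ⊗[ℚ_[ℓ]] C.etaleH1Tower ℓ}
    (hf' : f' ∈ X.omegaHom ι ρ)
    (Lbar : Coinv ρ₁ ψ' ⊗[ℂ] Coinv ρ₂ (χ * ψ'⁻¹) →ₛₗ[(ι : ℂ →+* AlgebraicClosure ℚ_[ℓ])]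
      AlgebraicClosure ℚ_[ℓ] ⊗[ℚ_[ℓ]] C.etaleH1Tower ℓ)
    (hfac : ∀ w : W, Lbar (coinvTprodQuot ρ₁ ρ₂ χ ψ' (Φ w)) = P (f' w)) (g : C.G)
    (t : Coinv ρ₁ ψ' ⊗[ℂ] Coinv ρ₂ (χ * ψ'⁻¹)) :
    Lbar ((rep ψ' ρV hc g).rTensor (Coinv ρ₂ (χ * ψ'⁻¹)) t) = (X.rhoEt g).baseChange (AlgebraicClosure ℚ_[ℓ]) (Lbar t) := by
  obtain ⟨x, rfl⟩ := coinvTprodQuot_surjective ρ₁ ρ₂ χ ψ' t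
  obtain ⟨w, rfl⟩ := Φ.surjective x
  rw [← coinvTprodQuot_rep ρ₁ ρ₂ χ ψ' ρV hc g, ← hΦ, hfac, hfac, (X.mem_omegaHom_iff ι ρ f').1 hf' g w, hPT]

/-- **slices of an equivariant `Lbar` are in the Hom-space**: transport along (f1′) `e` and freeze the multiplicity
coordinate `m`. [cite: Liu2021, proof of Thm. 4.15 (FJcycle.tex l. 2199–2212)] -/
theorem slice_mem_omegaHom (hc : ∀ (g : C.G) (h : H), Commute (ρV g) (ρ₁ h))
    (he : ∀ (g : C.G) (x : Coinv ρ₁ ψ'), e (rep ψ' ρV hc g x) = ρ' g (e x)) {χ₂ : H →* ℂˣ}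
    (Lbar : Coinv ρ₁ ψ' ⊗[ℂ] Coinv ρ₂ χ₂ →ₛₗ[(ι : ℂ →+* AlgebraicClosure ℚ_[ℓ])]
      AlgebraicClosure ℚ_[ℓ] ⊗[ℚ_[ℓ]] C.etaleH1Tower ℓ)
    (hL : ∀ (g : C.G) (t : Coinv ρ₁ ψ' ⊗[ℂ] Coinv ρ₂ χ₂),
      Lbar ((rep ψ' ρV hc g).rTensor (Coinv ρ₂ χ₂) t) = (X.rhoEt g).baseChange (AlgebraicClosure ℚ_[ℓ]) (Lbar t))
    (m : Coinv ρ₂ χ₂) :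
    (Lbar.comp (TensorProduct.congr e (LinearEquiv.refl ℂ (Coinv ρ₂ χ₂))).symm.toLinearMap).comp
        ((TensorProduct.mk ℂ W₁ (Coinv ρ₂ χ₂)).flip m) ∈ X.omegaHom ι ρ' := by
  refine (X.mem_omegaHom_iff ι ρ' _).2 fun g x₁ => ?_
  obtain ⟨y, rfl⟩ := e.surjective x₁
  -- the slice evaluated at `x₁` is `Lbar (e⁻¹ x₁ ⊗ m)` (definitional unfolding of the composite)
  show Lbar (e.symm (ρ' g (e y)) ⊗ₜ[ℂ] m) = (X.rhoEt g).baseChange (AlgebraicClosure ℚ_[ℓ]) (Lbar (e.symm (e y) ⊗ₜ[ℂ] m))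
  rw [← he, LinearEquiv.symm_apply_apply, LinearEquiv.symm_apply_apply]
  exact hL g (y ⊗ₜ[ℂ] m)

/-- **The per-label factorisation with equivariant slices (the `(M i, q i, g)` tail of the see-saw decomposition at one label, generic).**  With
`q w := (e ⊗ 1) (q_{ψ′} (Φ w)) : W₁ ⊗ Coinv ρ₂ (χψ′⁻¹)`: every `f′ ∈ X.omegaHom ι ρ` factors as `P ∘ f′ = g ∘ q` for an
`ι`-semilinear `g` all of whose slices `x ↦ g (x ⊗ m)` lie in `X.omegaHom ι ρ′`.  Proof: `L := P ∘ f′ ∘ Φ⁻¹` transforms under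
`repFst` by `ι ∘ ψ′` (`comp_repFst_eq_smul`), so factors through `q_{ψ′}` (`coinvTprodQuot_liftₛₗ`); the factor is
`𝔾`-equivariant because `q_{ψ′}` is (`coinvTprodQuot_rep`) and onto (`factor_rTensor_rep`); transport along `e`
(`slice_mem_omegaHom`). [cite: Liu2021, proof of Thm. 4.15 (FJcycle.tex l. 2199–2212); App. D §D.1 Step 3 (l. 5221)] -/
theorem exists_factor_slice_mem_omegaHom (hc : ∀ (g : C.G) (h : H), Commute (ρV g) (ρ₁ h))
    (hzc : ∀ (z : H) (v : S₁), ρV (zc z) v = ((c z : ℂˣ) : ℂ) • ρ₁ z v)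
    (hΦ : ∀ (g : C.G) (w : W),
      Φ (ρ g w) = rep χ (ρV.tprod (1 : Representation ℂ C.G S₂)) (commute_tprod_one ρ₁ ρ₂ ρV hc) g (Φ w))
    (he : ∀ (g : C.G) (x : Coinv ρ₁ ψ'), e (rep ψ' ρV hc g x) = ρ' g (e x))
    (hPT : ∀ (g : C.G) (x : AlgebraicClosure ℚ_[ℓ] ⊗[ℚ_[ℓ]] C.etaleH1Tower ℓ),
      P ((X.rhoEt g).baseChange (AlgebraicClosure ℚ_[ℓ]) x) = (X.rhoEt g).baseChange (AlgebraicClosure ℚ_[ℓ]) (P x))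
    (hPz : ∀ (z : H) (x : AlgebraicClosure ℚ_[ℓ] ⊗[ℚ_[ℓ]] C.etaleH1Tower ℓ),
      (X.rhoEt (zc z)).baseChange (AlgebraicClosure ℚ_[ℓ]) (P x) = ι (((ψ' z : ℂˣ) : ℂ) * ((c z : ℂˣ) : ℂ)) • P x)
    {f' : W →ₛₗ[(ι : ℂ →+* AlgebraicClosure ℚ_[ℓ])] AlgebraicClosure ℚ_[ℓ] ⊗[ℚ_[ℓ]] C.etaleH1Tower ℓ}
    (hf' : f' ∈ X.omegaHom ι ρ) :
    ∃ g : W₁ ⊗[ℂ] Coinv ρ₂ (χ * ψ'⁻¹) →ₛₗ[(ι : ℂ →+* AlgebraicClosure ℚ_[ℓ])]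
        AlgebraicClosure ℚ_[ℓ] ⊗[ℚ_[ℓ]] C.etaleH1Tower ℓ,
      (∀ w : W, P (f' w) =
        g (TensorProduct.congr e (LinearEquiv.refl ℂ (Coinv ρ₂ (χ * ψ'⁻¹))) (coinvTprodQuot ρ₁ ρ₂ χ ψ' (Φ w)))) ∧
      ∀ m : Coinv ρ₂ (χ * ψ'⁻¹),
        g.comp ((TensorProduct.mk ℂ W₁ (Coinv ρ₂ (χ * ψ'⁻¹))).flip m) ∈ X.omegaHom ι ρ' := by
  have hL := comp_repFst_eq_smul X ι ρ₁ ρ₂ χ ψ' ρV zc c ρ Φ P hc hzc hΦ hPT hPz hf'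
  obtain ⟨Lbar, hLbar, -⟩ := coinvTprodQuot_liftₛₗ ρ₁ ρ₂ χ ψ' _ hL
  -- `Lbar (q (Φ w)) = P (f′ w)`
  have hfac : ∀ w : W, Lbar (coinvTprodQuot ρ₁ ρ₂ χ ψ' (Φ w)) = P (f' w) := fun w => by
    have h := (LinearMap.congr_fun hLbar (Φ w)).symm
    rw [LinearMap.comp_apply, LinearMap.comp_apply, LinearMap.comp_apply, LinearEquiv.coe_toLinearMap,
      LinearEquiv.symm_apply_apply] at h
    exact h
  refine ⟨Lbar.comp (TensorProduct.congr e (LinearEquiv.refl ℂ (Coinv ρ₂ (χ * ψ'⁻¹)))).symm.toLinearMap,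
    fun w => ?_, slice_mem_omegaHom X ι ρ₁ ρ₂ ψ' ρV ρ' e hc he Lbar
      (factor_rTensor_rep X ι ρ₁ ρ₂ χ ψ' ρV ρ Φ P hc hΦ hPT hf' Lbar hfac)⟩
  rw [LinearMap.comp_apply, LinearEquiv.coe_toLinearMap, LinearEquiv.symm_apply_apply, hfac]

end Transfer

end Literature.NumberTheory.Automorphic.Liu2021.AppendixC.Sec42Data.EtaleHeckeDatum

end
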